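import Summits.RiemannHypothesis.RiemannHypothesis.Theorems.HardyZLehmerSplitSigmaLLaguerreEnergyTerms
import Summits.RiemannHypothesis.RiemannHypothesis.Theorems.HardyZLehmerSplitSigmaLSmooth
import Summits.RiemannHypothesis.RiemannHypothesis.Theorems.HardyZLehmerSplitSigmaLstub_secondDerivTest
import Summits.RiemannHypothesis.RiemannHypothesis.Theorems.SigmaLNoViolation
import Literature.NumberTheory.LFunctions.HardyZExtremaCriterionProofs
import Mathlib.Analysis.Calculus.Deriv.Slope
import HarnessLib

/-!
# Crux `SigmaL` (stmt-RiemannHypothesis-24253) — the ENERGY IDENTITY behind `stub_laguerreAtCritical`: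
# the Laguerre expression of Hardy's `Z` is minus the total zero energy plus a drift `≤ 4/t` (RH-free)

Skeleton `SigmaL_birth`, registered stub

  `stub_laguerreAtCritical : ∀ t > 3·10¹², Z'(t) = 0 → Z(t) ≠ 0 → Z(t)·Z''(t) < 0`

(`Z = Literature.NumberTheory.LFunctions.hardyZ`). The stub is RH-strength and stays OPEN (census of the
leafhand seats g0/g1: above the Platt–Trudgian height it is RH at the critical points of `Z`). The cone
theorems (`Theorems/HardyZLehmerSplitSigmaLLaguerreCone*.lean`) derive its conclusion from QUALITATIVE zero
geometry (no off-line zero with `t` in its doubled cone) through difference quotients of `Z'/Z`. This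
module (route-independent imports) supplies the EXACT identity underneath, by differentiating Ivić's
(2.1)–(2.2) once and the Hadamard zero sum TERMWISE (the tree's `Stark1974.SymmHadamardData` calculus,
`SymmHadamardData.iteratedDeriv_logDeriv_eq` at `k = 1`, Cauchy's formula + dominated convergence):

* §3 `hasDerivAt_neg_im_logDeriv_riemannXi`: `d/dt [−Im ξ'/ξ(½+it)] = Σₙ Re Zₙ(1, ½+it)`, where
  `Zₙ(1, s) = (s−ρₙ)⁻² + (s−(1−ρₙ))⁻²` runs over the pairs of zeros of `ξ` and (§2,
  `re_zeroTerm_one_eq_of_root`)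
  `Re (s−ρ)⁻² = ((β−½)² − (t−γ)²)/(((β−½)² + (t−γ)²)²)` is MINUS the energy of `ρ = β+iγ` at `t`;
* §4 `laguerre_eq_tsum_re_zeroTerm_add_deriv_drift`: `(Z''Z − Z'²)/Z²(t) = Σₙ Re Zₙ(1, ½+it) + c'(t)` with
  `c(u) = −2u/(u²+¼) + ½ Im ψ(¼ + iu/2)` the Gamma drift (`hasDerivAt_drift`), and `c'(t) ≤ 4/t` for `t ≥ 1`
  (`laguerre_sub_tsum_re_zeroTerm_le`, from the tree's increment bound `Ivic2003.corr_sub_le`); hence the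
  ENERGY INEQUALITY `(Z Z'' − Z'²)/Z² ≤ 4/t + Σₙ Re Zₙ(1, ½+it)`
  (`laguerre_le_drift_add_tsum_re_zeroTerm`) and
  the exact reformulation of the stub at `t`: `Z·Z'' < 0 ↔ Σₙ Re Zₙ(1, ½+it) + c'(t) < 0`
  (`laguerreAtCritical_iff_energy`);
* §5 at critical points: `Z·Z'' < 0` from an energy surplus `Σₙ Re Zₙ < −4/t`
(`laguerreAtCritical_of_energy`)
  and the ENERGY LOCATOR: a wrong-curvature/degenerate critical point, in particular a Lehmer violation
  (positive local minimum / negative local maximum), at `t ≥ 1` has total zero energy `≤ 4/t`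
  (`tsum_re_zeroTerm_ge_of_wrongCurvature`, `tsum_re_zeroTerm_ge_of_lehmer_violation`);
* §2/§6 termwise bookkeeping: a pair with `t` outside its exact cones has energy `≥ 0`
  (`re_zeroTerm_one_nonpos_of_offCone`), `≥ ((t−γ)²−¼)/(((t−γ)²+¼)²)` once `|t−γ| ≥ ½` whatever its real part
  (`re_zeroTerm_one_le_of_quarter_le`), the in-cone penalty is `≤ 1/((β−½)²+(t−γ)²) + …` (`re_zeroTerm_one_le`),
  and the FINITE ENERGY LAW `sum_re_zeroTerm_ge_of_wrongCurvature`: at a wrong-curvature critical point the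
  in-cone pairs pay for every finite family of off-cone pairs, up to `4/t`.

So the RH-free content of the stub is, exactly: "at every critical point `t > 3·10¹²` of `Z` with `Z(t) ≠ 0`
the zero energy `Σ_ρ ((t−γ)² − (β−½)²)/(((β−½)²+(t−γ)²)²)` exceeds the Gamma drift `c'(t)` (`≈ 2/t²`,
`≤ 4/t`)" — RH-strength as a whole (an off-line zero straight above `t` at horizontal distance `δ` costs
`1/δ²`), quantitative and local. NOTHING HERE PROVES OR ASSUMES RH; the stub and the crux stay OPEN.
References: Ivić 2003 §2 Prop. 1 [Ivic2003]; Lagarias–Montgomery–Odlyzko 1979 §3 (termwise-differentiated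
Hadamard expansion) [LagariasMontgomeryOdlyzko1979]; Edwards 1974 §8.3 [Edwards1974].
-/

noncomputable section

set_option linter.dupNamespace false
set_option autoImplicit false

open Complex Filter Set
open scoped Real Topology
open Literature.NumberTheory.LFunctions
open Literature.NumberTheory.LFunctions.Stark1974

namespace Summit.RiemannHypothesis.RiemannHypothesis.Theorems.SigmaLBirth

variable (D : SymmHadamardData riemannXi)

/-! ## §3. The ENERGY IDENTITY for the zero part: `d/dt [−Im ξ'/ξ(½+it)] = Σₙ Re Zₙ(1, ½+it)` -/

/-- **`(ξ'/ξ)'(s) = −Σₙ Zₙ(1, s)`** at every `s` with `ξ(s) ≠ 0` (the tree's explicit formula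
`SymmHadamardData.iteratedDeriv_logDeriv_eq` at `k = 1`, no pole term since `ξ(½) ≠ 0`).
[cite: LagariasMontgomeryOdlyzko1979, §3] -/
theorem deriv_logDeriv_riemannXi_eq {s : ℂ} (hs : riemannXi s ≠ 0) :
    deriv (logDeriv riemannXi) s = -∑' n, D.zeroTerm 1 s n := by
  have h := D.iteratedDeriv_logDeriv_eq differentiable_riemannXi hs 1
  rw [iteratedDeriv_one, symmHadamardData_m_eq_zero D] at h
  rw [h]
  simp

/-- The real parts `Re Zₙ(1, s)` are summable, with sum `Re Σₙ Zₙ(1, s)`. [folklore] -/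
theorem hasSum_re_zeroTerm_one {s : ℂ} (hs : riemannXi s ≠ 0) :
    HasSum (fun n ↦ (D.zeroTerm 1 s n).re) (∑' n, (D.zeroTerm 1 s n).re) := by
  have h := Complex.hasSum_re (D.summable_zeroTerm differentiable_riemannXi hs 1).hasSum
  rwa [Complex.re_tsum (D.summable_zeroTerm differentiable_riemannXi hs 1)] at h

/-- **ENERGY IDENTITY (zero part), RH-free.** At `t` with `ξ(½+it) ≠ 0`, the zero sum
`−Im ξ'/ξ(½+iu) = Σ_ρ (u−γ)/((β−½)² + (u−γ)²)` (Ivić (2.1), the tree's `SigmaLRung.hasSum_pairTerm`) is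
differentiable in `u` at `t` with derivative `Σₙ Re Zₙ(1, ½+it) = Σ_ρ ((β−½)² − (t−γ)²)/(((β−½)² +
(t−γ)²)²)`
— MINUS the total zero energy at `t` (termwise differentiation of the Hadamard expansion, justified by the
tree's Cauchy-formula lemma behind `SymmHadamardData.hasSum_zeroTerm`). [cite: Ivic2003, §2 (2.1)] -/
theorem hasDerivAt_neg_im_logDeriv_riemannXi {t : ℝ} (hξ : riemannXi (1 / 2 + (t : ℂ) * I) ≠ 0) :
    HasDerivAt (fun u : ℝ ↦ -(logDeriv riemannXi (1 / 2 + (u : ℂ) * I)).im)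
      (∑' n, (D.zeroTerm 1 (1 / 2 + (t : ℂ) * I) n).re) t := by
  set s : ℂ := 1 / 2 + (t : ℂ) * I with hs
  have hg : HasDerivAt (logDeriv riemannXi) (deriv (logDeriv riemannXi) s) s :=
    (SymmHadamardData.differentiableAt_logDeriv differentiable_riemannXi hξ).hasDerivAt
  have hcomp : HasDerivAt (fun u : ℝ ↦ logDeriv riemannXi (1 / 2 + (u : ℂ) * I))
      (deriv (logDeriv riemannXi) s * I) t := hg.comp t (hasDerivAt_critLinePt t)
  have him := Complex.imCLM.hasFDerivAt.comp_hasDerivAt t hcomp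
  have him' : HasDerivAt (fun u : ℝ ↦ (logDeriv riemannXi (1 / 2 + (u : ℂ) * I)).im)
      ((deriv (logDeriv riemannXi) s * I).im) t := by
    simpa only [Function.comp_def, Complex.imCLM_apply] using him
  have hval : -(deriv (logDeriv riemannXi) s * I).im = ∑' n, (D.zeroTerm 1 s n).re := by
    rw [Complex.mul_I_im, deriv_logDeriv_riemannXi_eq D hξ, Complex.neg_re, neg_neg,
      Complex.re_tsum (D.summable_zeroTerm differentiable_riemannXi hξ 1)]
  rw [← hval]
  exact him'.neg


/-! ## §4. The Laguerre expression of `Z`: `(Z'/Z)' = Σₙ Re Zₙ(1, ½+it) + c'(t)` with `c'(t) ≤ 4/t` -/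

/-- **`Z'/Z` is differentiable off the zeros of `Z`**, with the Laguerre expression
`(Z'/Z)'(t) = (Z''(t)Z(t) − Z'(t)²)/Z(t)²` as derivative (`Z` is `C²`,
`SigmaLBirth.hasDerivAt_deriv_hardyZ`).
[folklore] -/
theorem hasDerivAt_hardyZ_logDeriv {t : ℝ} (hZ : hardyZ t ≠ 0) :
    HasDerivAt (fun u ↦ deriv hardyZ u / hardyZ u)
      ((deriv (deriv hardyZ) t * hardyZ t - deriv hardyZ t * deriv hardyZ t) / hardyZ t ^ 2) t :=
  (hasDerivAt_deriv_hardyZ t).div (differentiable_hardyZ t).hasDerivAt hZ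

/-- **Ivić (2.2) near a point with `Z ≠ 0`**: for `u` near `t`,
`Z'/Z(u) = −Im ξ'/ξ(½+iu) + c(u)`, `c(u) = −2u/(u²+¼) + ½ Im ψ(¼ + iu/2)` (the tree's
`Ivic2003.deriv_hardyZ_div_eq` + `Ivic2003.neg_im_logDeriv_zeta_critPt`, valid wherever `ζ(½+iu) ≠ 0`,
which holds near `t` by continuity of `Z`). [cite: Ivic2003, §2 (2.1)–(2.2)] -/
theorem hardyZ_logDeriv_eq_near {t : ℝ} (hZ : hardyZ t ≠ 0) :
    ∀ᶠ u in 𝓝 t, deriv hardyZ u / hardyZ u =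
      -(logDeriv riemannXi (1 / 2 + (u : ℂ) * I)).im +
        (-(2 * u / (u ^ 2 + 1 / 4)) +
          (Complex.digamma ((1 / 4 : ℂ) + ((u / 2 : ℝ) : ℂ) * I)).im / 2) := by
  have hev : ∀ᶠ u in 𝓝 t, hardyZ u ≠ 0 := (continuous_hardyZ.continuousAt).eventually_ne hZ
  filter_upwards [hev] with u hu
  have hζ : riemannZeta (1 / 2 + (u : ℂ) * I) ≠ 0 := fun h0 ↦
    hu ((hardyZ_eq_zero_iff_holds u).2 h0)
  rw [Ivic2003.deriv_hardyZ_div_eq hζ, Ivic2003.neg_im_logDeriv_zeta_critPt hζ]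
  ring

/-- `Z(t) ≠ 0 ⇒ ξ(½+it) ≠ 0`. [folklore] -/
theorem riemannXi_critLine_ne_zero {t : ℝ} (hZ : hardyZ t ≠ 0) :
    riemannXi (1 / 2 + (t : ℂ) * I) ≠ 0 := fun h0 ↦
  hZ ((hardyZ_eq_zero_iff_holds t).2 ((riemannXi_eq_zero_iff_holds _).1 h0).1)

/-- **The drift `c(u) = −2u/(u²+¼) + ½ Im ψ(¼ + iu/2)` is differentiable at every `t` with `Z(t) ≠ 0`,
with derivative `c'(t) = (Z'/Z)'(t) − Σₙ Re Zₙ(1, ½+it)`** — this IS the energy identity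
`(Z'/Z)'(t) = Σₙ Re Zₙ(1, ½+it) + c'(t)`, stated without naming `c'` (as `c = Z'/Z + Im ξ'/ξ` near `t`,
§3 and `hasDerivAt_hardyZ_logDeriv`). RH-free; nothing here bears on the truth of RH.
[cite: Ivic2003, §2 (2.1)–(2.2)] -/
theorem hasDerivAt_drift {t : ℝ} (hZ : hardyZ t ≠ 0) :
    HasDerivAt (fun u : ℝ ↦ -(2 * u / (u ^ 2 + 1 / 4)) +
        (Complex.digamma ((1 / 4 : ℂ) + ((u / 2 : ℝ) : ℂ) * I)).im / 2)
      ((deriv (deriv hardyZ) t * hardyZ t - deriv hardyZ t * deriv hardyZ t) / hardyZ t ^ 2 -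
        ∑' n, (D.zeroTerm 1 (1 / 2 + (t : ℂ) * I) n).re) t := by
  have h := (hasDerivAt_hardyZ_logDeriv hZ).sub
    (hasDerivAt_neg_im_logDeriv_riemannXi D (riemannXi_critLine_ne_zero hZ))
  refine h.congr_of_eventuallyEq ?_
  filter_upwards [hardyZ_logDeriv_eq_near hZ] with u hu
  simp only [Pi.sub_apply]
  rw [hu]
  ring

/-- **ENERGY IDENTITY (exact, RH-free):**
`(Z''(t)Z(t) − Z'(t)²)/Z(t)² = Σₙ Re Zₙ(1, ½+it) + c'(t)` at every `t` with `Z(t) ≠ 0`, where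
`c'(t) = deriv (u ↦ −2u/(u²+¼) + ½ Im ψ(¼ + iu/2)) t` is the drift of the Gamma factor. Ivić's (2.1)–(2.2)
differentiated once, with the zero sum differentiated termwise. Nothing here bears on the truth of RH.
[cite: Ivic2003, §2 (2.1)–(2.2)] -/
theorem laguerre_eq_tsum_re_zeroTerm_add_deriv_drift {t : ℝ} (hZ : hardyZ t ≠ 0) :
    (deriv (deriv hardyZ) t * hardyZ t - deriv hardyZ t * deriv hardyZ t) / hardyZ t ^ 2 =
      (∑' n, (D.zeroTerm 1 (1 / 2 + (t : ℂ) * I) n).re) +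
        deriv (fun u : ℝ ↦ -(2 * u / (u ^ 2 + 1 / 4)) +
          (Complex.digamma ((1 / 4 : ℂ) + ((u / 2 : ℝ) : ℂ) * I)).im / 2) t := by
  rw [(hasDerivAt_drift D hZ).deriv]
  ring

/-- **The stub's conclusion at `t`, EXACTLY, in terms of the zeros (RH-free):** at a critical point `t` of
`Z` with `Z(t) ≠ 0`, `Z(t)·Z''(t) < 0 ↔ Σₙ Re Zₙ(1, ½+it) + c'(t) < 0` — the Laguerre inequality at a
critical point is precisely the statement that the total zero energy `−Σₙ Re Zₙ(1, ½+it)` exceeds the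
Gamma drift `c'(t)` (`≤ 4/t`, next lemma). So `stub_laguerreAtCritical` is EQUIVALENT to: at every critical
point `t > 3·10¹²` of `Z` with `Z(t) ≠ 0`, the zero energy beats the drift. A reformulation, not a proof;
the stub stays OPEN; nothing here bears on the truth of RH. [cite: Ivic2003, §2 Prop. 1 (energy form)] -/
theorem laguerreAtCritical_iff_energy {t : ℝ} (hd : deriv hardyZ t = 0) (hZ : hardyZ t ≠ 0) :
    hardyZ t * deriv (deriv hardyZ) t < 0 ↔
      (∑' n, (D.zeroTerm 1 (1 / 2 + (t : ℂ) * I) n).re) +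
          deriv (fun u : ℝ ↦ -(2 * u / (u ^ 2 + 1 / 4)) +
            (Complex.digamma ((1 / 4 : ℂ) + ((u / 2 : ℝ) : ℂ) * I)).im / 2) t < 0 := by
  rw [← laguerre_eq_tsum_re_zeroTerm_add_deriv_drift D hZ, hd]
  have hsq : 0 < hardyZ t ^ 2 := by positivity
  have e : (deriv (deriv hardyZ) t * hardyZ t - 0 * 0) / hardyZ t ^ 2 =
      hardyZ t * deriv (deriv hardyZ) t / hardyZ t ^ 2 := by ring
  rw [e, div_neg_iff]
  constructor
  · intro h
    exact Or.inr ⟨h, hsq⟩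
  · rintro (⟨_, h⟩ | ⟨h, _⟩)
    · exact absurd h (not_lt.2 hsq.le)
    · exact h

/-- **`c'(t) ≤ 4/t` for `t ≥ 1`** (from the tree's increment bound `Ivic2003.corr_sub_le`:
`c(u) − c(t) ≤ 4(u − t)/t` for `1 ≤ t ≤ u`, by letting `u ↓ t` in the slopes). In the energy form:
`(Z'/Z)'(t) − Σₙ Re Zₙ(1, ½+it) ≤ 4/t`. RH-free. [cite: Ivic2003, §2, proof of Prop. 1 (`(f'/f)' ≪ 1/t`)] -/
theorem laguerre_sub_tsum_re_zeroTerm_le {t : ℝ} (h1 : 1 ≤ t) (hZ : hardyZ t ≠ 0) :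
    (deriv (deriv hardyZ) t * hardyZ t - deriv hardyZ t * deriv hardyZ t) / hardyZ t ^ 2 -
        ∑' n, (D.zeroTerm 1 (1 / 2 + (t : ℂ) * I) n).re ≤ 4 / t := by
  have hd := hasDerivAt_drift D hZ
  rw [hasDerivAt_iff_tendsto_slope] at hd
  have hd' := hd.mono_left
    (nhdsWithin_mono t (show Set.Ioi t ⊆ {t}ᶜ from fun u hu ↦ (ne_of_gt hu : u ≠ t)))
  refine le_of_tendsto hd' ?_
  refine eventually_nhdsWithin_of_forall fun u (hu : t < u) ↦ ?_
  have ht : 0 < t := by linarith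
  rw [slope_def_field, div_le_div_iff₀ (sub_pos.2 hu) ht]
  have hc := (le_div_iff₀ ht).1 (Ivic2003.corr_sub_le h1 hu.le)
  linarith

/-- **ENERGY INEQUALITY for the Laguerre expression of Hardy's `Z` (RH-free).** For `t ≥ 1` with
`Z(t) ≠ 0` and any Hadamard datum `D` of `ξ`:

  `(Z(t)Z''(t) − Z'(t)²)/Z(t)² ≤ 4/t + Σₙ Re Zₙ(1, ½+it)`,

where `Re Zₙ(1, ½+it) = ((βₙ−½)² − (t−γₙ)²)/(((βₙ−½)² + (t−γₙ)²)²) + (partner term)` is MINUS the energy of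
the `n`-th pair of zeros at `t` (`re_zeroTerm_one_eq_of_root`): nonpositive off the exact cone
`|t − γₙ| ≥ |βₙ − ½|` (`re_zeroTerm_one_nonpos_of_offCone`), at most `−((t−γₙ)² − ¼)/(((t−γₙ)² + ¼)²)`
once `|t − γₙ| ≥ ½` (`re_zeroTerm_one_le_of_quarter_le`), and never more than `1/((βₙ−½)² + (t−γₙ)²) + …`
(`re_zeroTerm_one_le`). The full Laguerre inequality `Z Z'' − Z'² < 0` at `t` therefore holds as soon as
the total zero energy at `t` exceeds `4/t`. Exact Hadamard bookkeeping behind the cone theorems of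
`Theorems/HardyZLehmerSplitSigmaLLaguerreCone*.lean`; nothing here bears on the truth of RH.
[cite: Ivic2003, §2 Prop. 1 (energy form)] -/
theorem laguerre_le_drift_add_tsum_re_zeroTerm {t : ℝ} (h1 : 1 ≤ t) (hZ : hardyZ t ≠ 0) :
    (hardyZ t * deriv (deriv hardyZ) t - deriv hardyZ t ^ 2) / hardyZ t ^ 2 ≤
      4 / t + ∑' n, (D.zeroTerm 1 (1 / 2 + (t : ℂ) * I) n).re := by
  have h := laguerre_sub_tsum_re_zeroTerm_le D h1 hZ
  have e : (hardyZ t * deriv (deriv hardyZ) t - deriv hardyZ t ^ 2) / hardyZ t ^ 2 =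
      (deriv (deriv hardyZ) t * hardyZ t - deriv hardyZ t * deriv hardyZ t) / hardyZ t ^ 2 := by
    ring
  rw [e]
  linarith

/-! ## §5. At critical points: the ENERGY LOCATOR for wrong-curvature points and Lehmer violations -/

/-- **At a critical point `t ≥ 1` of `Z` with `Z(t) ≠ 0`: `Z''(t)/Z(t) ≤ 4/t + Σₙ Re Zₙ(1, ½+it)`.**
RH-free. [cite: Ivic2003, §2 Prop. 1 (energy form, at critical points)] -/
theorem deriv2_div_le_of_critical {t : ℝ} (h1 : 1 ≤ t) (hd : deriv hardyZ t = 0) (hZ : hardyZ t ≠ 0) :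
    deriv (deriv hardyZ) t / hardyZ t ≤ 4 / t + ∑' n, (D.zeroTerm 1 (1 / 2 + (t : ℂ) * I) n).re := by
  have h := laguerre_le_drift_add_tsum_re_zeroTerm D h1 hZ
  have e : (hardyZ t * deriv (deriv hardyZ) t - deriv hardyZ t ^ 2) / hardyZ t ^ 2 =
      deriv (deriv hardyZ) t / hardyZ t := by
    rw [hd]
    field_simp
    ring
  rwa [e] at h

/-- **The stub's conclusion from an energy surplus (RH-free sufficient condition).** At a critical point
`t ≥ 1` of `Z` with `Z(t) ≠ 0`: if the total zero energy exceeds the drift, `Σₙ Re Zₙ(1, ½+it) < −4/t`,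
then `Z(t)·Z''(t) < 0`. Every pair of zeros with `t` outside its exact cones contributes energy `≥ 0`,
a pair with an ordinate at distance `∈ [½, 8]` from `t` contributes `> 0.015`, so this subsumes the cone
theorems; the stub itself stays OPEN (RH-strength). Nothing here bears on the truth of RH.
[cite: Ivic2003, §2 Prop. 1 (energy form)] -/
theorem laguerreAtCritical_of_energy {t : ℝ} (h1 : 1 ≤ t) (hd : deriv hardyZ t = 0) (hZ : hardyZ t ≠ 0)
    (hE : ∑' n, (D.zeroTerm 1 (1 / 2 + (t : ℂ) * I) n).re < -(4 / t)) :
    hardyZ t * deriv (deriv hardyZ) t < 0 := by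
  have h := deriv2_div_le_of_critical D h1 hd hZ
  have hneg : deriv (deriv hardyZ) t / hardyZ t < 0 := by linarith
  have hsq : 0 < hardyZ t ^ 2 := by positivity
  have e : hardyZ t * deriv (deriv hardyZ) t = (deriv (deriv hardyZ) t / hardyZ t) * hardyZ t ^ 2 := by
    field_simp
  rw [e]
  exact mul_neg_of_neg_of_pos hneg hsq

/-- **ENERGY LOCATOR (RH-free).** A wrong-curvature or degenerate critical point of `Z`
(`Z'(t) = 0`, `Z(t) ≠ 0`, `Z(t)·Z''(t) ≥ 0`) at `t ≥ 1` has TOTAL ZERO ENERGY AT MOST THE DRIFT: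
`−4/t ≤ Σₙ Re Zₙ(1, ½+it)`, i.e. `Σ_pairs energy ≤ 4/t`. Since every pair with `t` outside its exact cones
has energy `≥ 0` and the in-cone penalty of a pair is `≤ 1/((β−½)² + (t−γ)²) + …`, the zeros whose exact
cone contains `t` must pay, out of `Σ 1/dist²`, for the energy of EVERY other pair minus `4/t`
(`sum_re_zeroTerm_ge_of_wrongCurvature`). Contrapositive bookkeeping for the crux; nothing here bears on
the truth of RH. [cite: Ivic2003, §2 Prop. 1 (energy form)] -/
theorem tsum_re_zeroTerm_ge_of_wrongCurvature {t : ℝ} (h1 : 1 ≤ t) (hd : deriv hardyZ t = 0)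
    (hZ : hardyZ t ≠ 0) (hL : 0 ≤ hardyZ t * deriv (deriv hardyZ) t) :
    -(4 / t) ≤ ∑' n, (D.zeroTerm 1 (1 / 2 + (t : ℂ) * I) n).re := by
  by_contra hlt
  push Not at hlt
  exact absurd hL (not_le.2 (laguerreAtCritical_of_energy D h1 hd hZ hlt))

/-- **ENERGY LOCATOR for Lehmer violations (RH-free).** A positive local minimum or a negative local
maximum of Hardy's `Z` at `t ≥ 1` has total zero energy at most the drift: `−4/t ≤ Σₙ Re Zₙ(1, ½+it)`
(second-derivative test `SigmaLBirth.stub_secondDerivTest` + `tsum_re_zeroTerm_ge_of_wrongCurvature`).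
Unconditional; the crux `SigmaL` stays OPEN; nothing here bears on the truth of RH.
[cite: Ivic2003, §2 Prop. 1 (energy form)] -/
theorem tsum_re_zeroTerm_ge_of_lehmer_violation {t : ℝ} (h1 : 1 ≤ t)
    (hv : (IsLocalMin hardyZ t ∧ 0 < hardyZ t) ∨ (IsLocalMax hardyZ t ∧ hardyZ t < 0)) :
    -(4 / t) ≤ ∑' n, (D.zeroTerm 1 (1 / 2 + (t : ℂ) * I) n).re := by
  rcases hv with ⟨hmin, hpos⟩ | ⟨hmax, hneg⟩
  · obtain ⟨hd, hdd⟩ := (stub_secondDerivTest t).1 hmin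
    exact tsum_re_zeroTerm_ge_of_wrongCurvature D h1 hd hpos.ne' (mul_nonneg hpos.le hdd)
  · obtain ⟨hd, hdd⟩ := (stub_secondDerivTest t).2 hmax
    exact tsum_re_zeroTerm_ge_of_wrongCurvature D h1 hd hneg.ne
      (mul_nonneg_of_nonpos_of_nonpos hneg.le hdd)

/-! ## §6. Finite bookkeeping: the in-cone zeros pay for every finite family of off-cone zeros -/

/-- **Dropping nonpositive terms.** If every pair term outside the finite index set `S` is `≤ 0` at `t`
(e.g. `t` is outside the exact cones of all pairs not in `S`), then
`Σₙ Re Zₙ(1, ½+it) ≤ Σ_{n ∈ S} Re Zₙ(1, ½+it)`. [folklore] -/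
theorem tsum_re_zeroTerm_le_sum {t : ℝ} (hZ : hardyZ t ≠ 0) (S : Finset ℕ)
    (hS : ∀ n ∉ S, (D.zeroTerm 1 (1 / 2 + (t : ℂ) * I) n).re ≤ 0) :
    ∑' n, (D.zeroTerm 1 (1 / 2 + (t : ℂ) * I) n).re ≤
      ∑ n ∈ S, (D.zeroTerm 1 (1 / 2 + (t : ℂ) * I) n).re := by
  have hsum := (hasSum_re_zeroTerm_one D (riemannXi_critLine_ne_zero hZ)).summable
  have h := hsum.neg.sum_le_tsum S (fun n hn ↦ by simpa using hS n hn)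
  rw [tsum_neg, Finset.sum_neg_distrib] at h
  linarith

/-- **THE FINITE ENERGY LAW at a wrong-curvature critical point (RH-free).** Let `t ≥ 1`, `Z'(t) = 0`,
`Z(t) ≠ 0`, `Z(t)·Z''(t) ≥ 0` (in particular a Lehmer violation). For EVERY finite set `S` of pair indices
such that all pairs outside `S` have `t` outside their exact cones:
`−4/t ≤ Σ_{n ∈ S} Re Zₙ(1, ½+it)` — the (negative-energy) in-cone pairs inside `S` outweigh all the
(positive-energy) off-cone pairs one cares to put into `S`, up to the drift `4/t`. With
`re_zeroTerm_one_le` / `re_zeroTerm_one_le_of_quarter_le` this is the quantitative form of "violations sit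
beneath off-line zeros": `Σ_{in-cone} [1/((β−½)²+(t−γ)²) + …] ≥ Σ_{chosen off-cone, dist ≥ ½}
((t−γ)²−¼)/(((t−γ)²+¼)²) − 4/t`.
Nothing here bears on the truth of RH. [cite: Ivic2003, §2 Prop. 1 (energy form)] -/
theorem sum_re_zeroTerm_ge_of_wrongCurvature {t : ℝ} (h1 : 1 ≤ t) (hd : deriv hardyZ t = 0)
    (hZ : hardyZ t ≠ 0) (hL : 0 ≤ hardyZ t * deriv (deriv hardyZ) t) (S : Finset ℕ)
    (hS : ∀ n ∉ S, (D.zeroTerm 1 (1 / 2 + (t : ℂ) * I) n).re ≤ 0) :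
    -(4 / t) ≤ ∑ n ∈ S, (D.zeroTerm 1 (1 / 2 + (t : ℂ) * I) n).re :=
  (tsum_re_zeroTerm_ge_of_wrongCurvature D h1 hd hZ hL).trans (tsum_re_zeroTerm_le_sum D hZ S hS)

/-- **Corollary: no pair off-cone everywhere can coexist with a wrong-curvature critical point unless the
in-cone pairs pay for it.** Special case `S = {n₀} ∪ (in-cone pairs)` is left to the user; here the
cleanest instance: if EVERY pair has `t` outside its exact cones (all terms `≤ 0`) then a wrong-curvature
critical point at `t ≥ 1` forces `Re Zₙ(1, ½+it) ≥ −4/t` for each single `n`, i.e. no pair may carry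
energy `> 4/t` at `t` — impossible for a pair with an ordinate at distance `∈ [½, 8]` from `t` once
`t > 300` (energy `> 0.015 > 4/t`). Nothing here bears on the truth of RH.
[cite: Ivic2003, §2 Prop. 1 (energy form)] -/
theorem re_zeroTerm_ge_of_wrongCurvature_of_allOffCone {t : ℝ} (h1 : 1 ≤ t)
    (hd : deriv hardyZ t = 0) (hZ : hardyZ t ≠ 0) (hL : 0 ≤ hardyZ t * deriv (deriv hardyZ) t)
    (hoff : ∀ n, (D.zeroTerm 1 (1 / 2 + (t : ℂ) * I) n).re ≤ 0) (n₀ : ℕ) :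
    -(4 / t) ≤ (D.zeroTerm 1 (1 / 2 + (t : ℂ) * I) n₀).re := by
  have h := sum_re_zeroTerm_ge_of_wrongCurvature D h1 hd hZ hL {n₀} (fun n _ ↦ hoff n)
  simpa using h

/-! ## §7. Windows: an energy surplus off the zeros of `Z` makes `Z'/Z` strictly decreasing -/

/-- **Energy form of the local Ivić theorem (RH-free).** On a zero-free interval `(a, a')` of `Z` with
`a ≥ 1`, if at every point the total zero energy exceeds the drift, `Σₙ Re Zₙ(1, ½+iu) < −4/u`, then
`Z'/Z` is strictly decreasing on `(a, a')` (its derivative is the Laguerre expression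
`≤ 4/u + Σₙ Re Zₙ < 0`, `laguerre_le_drift_add_tsum_re_zeroTerm`). Generalises the cone form
`strictAntiOn_logDeriv_of_offCones` (`Theorems/HardyZLehmerSplitSigmaLLaguerreConeFull.lean`) from the
qualitative cone condition to the exact energy condition. Nothing here bears on the truth of RH.
[cite: Ivic2003, §2 Prop. 1 (energy form, local)] -/
theorem strictAntiOn_hardyZ_logDeriv_of_energy {a a' : ℝ} (ha : 1 ≤ a)
    (hfree : ∀ u ∈ Ioo a a', hardyZ u ≠ 0)
    (hE : ∀ u ∈ Ioo a a', ∑' n, (D.zeroTerm 1 (1 / 2 + (u : ℂ) * I) n).re < -(4 / u)) :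
    StrictAntiOn (fun u ↦ deriv hardyZ u / hardyZ u) (Ioo a a') := by
  refine strictAntiOn_of_deriv_neg (convex_Ioo a a') ?_ ?_
  · intro u hu
    exact (hasDerivAt_hardyZ_logDeriv (hfree u hu)).continuousAt.continuousWithinAt
  · intro u hu
    rw [interior_Ioo] at hu
    have h1 : 1 ≤ u := ha.trans hu.1.le
    rw [(hasDerivAt_hardyZ_logDeriv (hfree u hu)).deriv]
    have h := laguerre_sub_tsum_re_zeroTerm_le D h1 (hfree u hu)
    have h' := hE u hu
    linarith

/-- **No Lehmer violation on a window from an energy surplus (RH-free).** If `A ≥ 1` and at every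
`u ∈ (A, B)` with `Z(u) ≠ 0` the total zero energy exceeds the drift (`Σₙ Re Zₙ(1, ½+iu) < −4/u`), then
every local minimum of `Z` in `(A, B)` has `Z ≤ 0` and every local maximum has `Z ≥ 0` — the crux
`SigmaL`'s clause on `(A, B)` (`SigmaLRung.noViolation_of_strictAnti` + the previous theorem). The energy
hypothesis is RH-strength above the Platt–Trudgian height; the crux stays OPEN; nothing here bears on the
truth of RH. [cite: Ivic2003, §2 Prop. 1 (energy form, windowed)] -/
theorem noViolationOn_of_energy {A B : ℝ} (hA : 1 ≤ A)
    (hE : ∀ u ∈ Ioo A B, hardyZ u ≠ 0 →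
      ∑' n, (D.zeroTerm 1 (1 / 2 + (u : ℂ) * I) n).re < -(4 / u)) :
    ∀ t : ℝ, A < t → t < B →
      (IsLocalMin hardyZ t → hardyZ t ≤ 0) ∧ (IsLocalMax hardyZ t → 0 ≤ hardyZ t) :=
  SigmaLRung.noViolation_of_strictAnti fun _ _ haA ha'B hfree ↦
    strictAntiOn_hardyZ_logDeriv_of_energy D (hA.trans haA) hfree
      fun u hu ↦ hE u ⟨lt_of_le_of_lt haA hu.1, lt_of_lt_of_le hu.2 ha'B⟩ (hfree u hu)

end Summit.RiemannHypothesis.RiemannHypothesis.Theorems.SigmaLBirth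

end
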